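import Mathlib.Analysis.Calculus.Deriv.MeanValue
import Mathlib.Analysis.SpecialFunctions.ExpDeriv
import Mathlib.Analysis.SpecialFunctions.Sqrt
import Mathlib.Analysis.SpecialFunctions.Pow.Real
import Mathlib.MeasureTheory.Integral.IntervalIntegral.FundThmCalculus
import Mathlib.Analysis.Complex.ExponentialBounds
import Summits.NavierStokesRegularity.NavierStokesRegularity.Theorems.PerpetualPumpAveragedTypeIBlowupLinearComparison

/-!
# Crux `PerpetualPump.AveragedTypeIBlowup` (stmt-NavierStokesRegularity-1835), line `Sketch`:
# tools for the stub `previousPair` — damped scalar equations `x' = -κ R x + F`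

Generic one-dimensional ODE estimates used by the proof of the registered stub `stub_previousPair`
(the pair behind the front after a hand-off). All statements concern a function `x` continuous on
`[t₀, t₁]` with `x' = -κ R(t) x + F(t)` inside, `R, F` continuous:

* `previousPair_sq_le` — if `R > 0` and `|F| ≤ c κ R`, then `x(t)² ≤ c² + e^{-κ∫R} x(t₀)²`
  (the function `x² - c²` is a sub-solution of `y' = -κ R y`);
* `previousPair_neg_le` — under the same domination, `-c ≤ x` persists (`x + c` is a
  super-solution of `y' = -κ R y`);
* `previousPair_l1_le` — if `R ≥ 0`, the `L¹` bound `κ ∫ R |x| ≤ |x(t₀)| + ∫ |F|`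
  (regularised absolute value `√(x² + ε²)`);
* `previousPair_energy` — the energy identity `2κ ∫ R x² = x(t₀)² - x(t)² + 2 ∫ x F`;
* `previousPair_duhamel` — the Duhamel formula for a constant rate, `y' = -κ y + g`;
* small numerical facts about `exp`.

Everything is folklore calculus (integrating factors), Mathlib only, on top of the landed
comparison principle `linearComparison_upper/lower`.
-/

noncomputable section

-- the summit namespace `…NavierStokesRegularity.NavierStokesRegularity…` is the tree convention
set_option linter.dupNamespace false

open MeasureTheory Set Filter Topology

namespace Summit.NavierStokesRegularity.NavierStokesRegularity.Theorems.PerpetualPumpAveragedTypeIBlowup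

/-- **Squares under variable damping.** If `x' = -κ R x + F` inside `[t₀, t₁]` with `R > 0` and
`|F| ≤ c κ R`, then `x(t)² ≤ c² + e^{-κ ∫_{t₀}^t R} x(t₀)²` on `[t₀, t₁]`: indeed
`(x² - c²)' = -2κRx² + 2xF ≤ -κ R (x² - c²)`. [folklore] -/
theorem previousPair_sq_le {x R F : ℝ → ℝ} {κ c t₀ t₁ : ℝ} (h01 : t₀ ≤ t₁) (hκ : 0 < κ)
    (hx : ContinuousOn x (Icc t₀ t₁)) (hR : ContinuousOn R (Icc t₀ t₁))
    (hd : ∀ t ∈ Ioo t₀ t₁, HasDerivAt x (-(κ * R t * x t) + F t) t)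
    (hRpos : ∀ t ∈ Icc t₀ t₁, 0 < R t)
    (hFR : ∀ t ∈ Icc t₀ t₁, |F t| ≤ c * (κ * R t)) {t : ℝ} (ht : t ∈ Icc t₀ t₁) :
    x t ^ 2 ≤ c ^ 2 + Real.exp (-(κ * ∫ s in t₀..t, R s)) * x t₀ ^ 2 := by
  have hK : ContinuousOn (fun t => -(κ * R t)) (Icc t₀ t₁) := (continuousOn_const.mul hR).neg
  have hf : ContinuousOn (fun _ : ℝ => (0 : ℝ)) (Icc t₀ t₁) := continuousOn_const
  have hy : ContinuousOn (fun t => x t ^ 2 - c ^ 2) (Icc t₀ t₁) := (hx.pow 2).sub continuousOn_const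
  have hd' : ∀ s ∈ Ioo t₀ t₁, ∃ y' : ℝ, HasDerivAt (fun t => x t ^ 2 - c ^ 2) y' s ∧
      y' ≤ -(κ * R s) * (x s ^ 2 - c ^ 2) + 0 := by
    intro s hs
    refine ⟨_, ((hd s hs).pow 2).sub_const _, ?_⟩
    have hsI : s ∈ Icc t₀ t₁ := Ioo_subset_Icc_self hs
    have hRs := hRpos s hsI
    have hκR : 0 < κ * R s := mul_pos hκ hRs
    have h1 : F s * x s ≤ c * (κ * R s) * |x s| := by
      calc F s * x s ≤ |F s * x s| := le_abs_self _
        _ = |F s| * |x s| := abs_mul _ _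
        _ ≤ c * (κ * R s) * |x s| := mul_le_mul_of_nonneg_right (hFR s hsI) (abs_nonneg _)
    norm_num
    nlinarith [mul_nonneg hκR.le (sq_nonneg (|x s| - c)), sq_abs (x s), h1, abs_nonneg (x s)]
  have h := linearComparison_upper h01 hK hf hy hd' ht
  simp only [mul_zero, intervalIntegral.integral_zero, add_zero, intervalIntegral.integral_neg,
    intervalIntegral.integral_const_mul] at h
  have hE := Real.exp_pos (-(κ * ∫ s in t₀..t, R s))
  nlinarith [mul_nonneg hE.le (sq_nonneg c)]

/-- **Sign floor under variable damping.** If `x' = -κ R x + F` inside `[t₀, t₁]` with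
`|F| ≤ c κ R` and `-c ≤ x(t₀)`, then `-c ≤ x(t)` on `[t₀, t₁]` (`x + c` is a super-solution of
`y' = -κ R y`). [folklore] -/
theorem previousPair_neg_le {x R F : ℝ → ℝ} {κ c t₀ t₁ : ℝ} (h01 : t₀ ≤ t₁)
    (hx : ContinuousOn x (Icc t₀ t₁)) (hR : ContinuousOn R (Icc t₀ t₁))
    (hd : ∀ t ∈ Ioo t₀ t₁, HasDerivAt x (-(κ * R t * x t) + F t) t)
    (hFR : ∀ t ∈ Icc t₀ t₁, |F t| ≤ c * (κ * R t)) (h0 : -c ≤ x t₀) {t : ℝ}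
    (ht : t ∈ Icc t₀ t₁) : -c ≤ x t := by
  have hK : ContinuousOn (fun t => -(κ * R t)) (Icc t₀ t₁) := (continuousOn_const.mul hR).neg
  have hf : ContinuousOn (fun _ : ℝ => (0 : ℝ)) (Icc t₀ t₁) := continuousOn_const
  have hy : ContinuousOn (fun t => x t + c) (Icc t₀ t₁) := hx.add continuousOn_const
  have hd' : ∀ s ∈ Ioo t₀ t₁, ∃ y' : ℝ, HasDerivAt (fun t => x t + c) y' s ∧
      -(κ * R s) * (x s + c) + 0 ≤ y' := by
    intro s hs
    refine ⟨_, (hd s hs).add_const _, ?_⟩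
    have h1 := (abs_le.1 (hFR s (Ioo_subset_Icc_self hs))).1
    nlinarith [h1]
  have h := linearComparison_lower h01 hK hf hy hd' ht
  simp only [mul_zero, intervalIntegral.integral_zero, add_zero] at h
  have hE := Real.exp_pos (∫ s in t₀..t, -(κ * R s))
  nlinarith [mul_nonneg hE.le (show 0 ≤ x t₀ + c by linarith)]

/-- Pointwise key to the `L¹` bound: with `p = √(x² + ε²)`,
`x (-(κ R x) + F) + p (κ R |x| - κ ε R - |F|) ≤ 0` for `κ, R, ε ≥ 0`. [folklore] -/
theorem previousPair_l1_key (x F κ R ε : ℝ) (hκ : 0 ≤ κ) (hR : 0 ≤ R) (hε : 0 < ε) :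
    x * (-(κ * R * x) + F) +
      Real.sqrt (x ^ 2 + ε ^ 2) * (κ * (R * |x|) - κ * ε * R - |F|) ≤ 0 := by
  set p := Real.sqrt (x ^ 2 + ε ^ 2) with hp
  have hp2 : p ^ 2 = x ^ 2 + ε ^ 2 := by
    rw [hp, Real.sq_sqrt (by positivity)]
  have hp0 : 0 ≤ p := Real.sqrt_nonneg _
  have hpx : |x| ≤ p := by
    rw [hp]; refine Real.abs_le_sqrt ?_; nlinarith
  have hpε : ε ≤ p := by
    rw [hp]; exact (Real.le_sqrt' hε).2 (by nlinarith [sq_nonneg x])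
  have hple : p ≤ |x| + ε := by
    rw [hp]
    refine Real.sqrt_le_iff.2 ⟨by positivity, ?_⟩
    nlinarith [abs_nonneg x, sq_abs x]
  -- `p (|x| - ε) ≤ x²`
  have hkey : p * (|x| - ε) ≤ x ^ 2 := by
    rcases le_or_gt ε |x| with h | h
    · calc p * (|x| - ε) ≤ (|x| + ε) * (|x| - ε) :=
            mul_le_mul_of_nonneg_right hple (by linarith)
        _ = |x| ^ 2 - ε ^ 2 := by ring
        _ ≤ x ^ 2 := by rw [sq_abs]; nlinarith
    · have : p * (|x| - ε) ≤ 0 := mul_nonpos_of_nonneg_of_nonpos hp0 (by linarith)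
      nlinarith [sq_nonneg x]
  have h1 : x * F ≤ |F| * p := by
    calc x * F ≤ |x * F| := le_abs_self _
      _ = |F| * |x| := by rw [abs_mul, mul_comm]
      _ ≤ |F| * p := mul_le_mul_of_nonneg_left hpx (abs_nonneg _)
  have h2 : κ * R * (p * |x| - x ^ 2 - ε * p) ≤ 0 := by
    apply mul_nonpos_of_nonneg_of_nonpos (mul_nonneg hκ hR)
    nlinarith [hkey]
  nlinarith [h1, h2]

/-- **`L¹` bound under nonnegative damping.** If `x' = -κ R x + F` inside `[t₀, t₁]` with
`R ≥ 0`, `κ ≥ 0`, then `κ ∫_{t₀}^t R |x| ≤ |x(t₀)| + ∫_{t₀}^t |F|` for `t ∈ [t₀, t₁]`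
(differentiate `√(x² + ε²)` and let `ε → 0`). [folklore] -/
theorem previousPair_l1_le {x R F : ℝ → ℝ} {κ t₀ t₁ : ℝ} (hκ : 0 ≤ κ)
    (hx : ContinuousOn x (Icc t₀ t₁)) (hR : ContinuousOn R (Icc t₀ t₁))
    (hF : ContinuousOn F (Icc t₀ t₁))
    (hd : ∀ t ∈ Ioo t₀ t₁, HasDerivAt x (-(κ * R t * x t) + F t) t)
    (hRnn : ∀ t ∈ Icc t₀ t₁, 0 ≤ R t) {t : ℝ} (ht : t ∈ Icc t₀ t₁) :
    κ * ∫ s in t₀..t, R s * |x s| ≤ |x t₀| + ∫ s in t₀..t, |F s| := by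
  have h0t : t₀ ≤ t := ht.1
  -- continuity facts on `[t₀, t]`
  have hx' : ContinuousOn x (Icc t₀ t) := hx.mono (Icc_subset_Icc_right ht.2)
  have hR' : ContinuousOn R (Icc t₀ t) := hR.mono (Icc_subset_Icc_right ht.2)
  have hF' : ContinuousOn F (Icc t₀ t) := hF.mono (Icc_subset_Icc_right ht.2)
  have hRx : ContinuousOn (fun s => R s * |x s|) (Icc t₀ t) := hR'.mul hx'.abs
  have hIR : IntervalIntegrable R volume t₀ t := hR'.intervalIntegrable_of_Icc h0t
  have hIRx : IntervalIntegrable (fun s => R s * |x s|) volume t₀ t :=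
    hRx.intervalIntegrable_of_Icc h0t
  have hIF : IntervalIntegrable (fun s => |F s|) volume t₀ t :=
    hF'.abs.intervalIntegrable_of_Icc h0t
  have hIRnn : 0 ≤ ∫ s in t₀..t, R s :=
    intervalIntegral.integral_nonneg h0t fun s hs => hRnn s ⟨hs.1, hs.2.trans ht.2⟩
  -- the bound with an `ε`
  have hεbound : ∀ ε : ℝ, 0 < ε →
      κ * ∫ s in t₀..t, R s * |x s| ≤
        |x t₀| + (∫ s in t₀..t, |F s|) + ε * (1 + κ * ∫ s in t₀..t, R s) := by
    intro ε hε
    -- the integrand `g`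
    have hg : ContinuousOn (fun s => κ * (R s * |x s|) - κ * ε * R s - |F s|) (Icc t₀ t) :=
      ((continuousOn_const.mul hRx).sub (continuousOn_const.mul hR')).sub hF'.abs
    obtain ⟨hGc, hGd⟩ := linearComparison_primitive h0t hg
    have hφc : ContinuousOn (fun s => Real.sqrt (x s ^ 2 + ε ^ 2)) (Icc t₀ t) :=
      ((hx'.pow 2).add continuousOn_const).sqrt
    have hanti : AntitoneOn (fun s => Real.sqrt (x s ^ 2 + ε ^ 2) +
        ∫ u in t₀..s, (κ * (R u * |x u|) - κ * ε * R u - |F u|)) (Icc t₀ t) := by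
      refine antitoneOn_of_hasDerivWithinAt_nonpos (convex_Icc t₀ t) (hφc.add hGc)
        (f' := fun s => (↑(2 : ℕ) * x s ^ (2 - 1) * (-(κ * R s * x s) + F s)) /
            (2 * Real.sqrt (x s ^ 2 + ε ^ 2)) +
          (κ * (R s * |x s|) - κ * ε * R s - |F s|)) ?_ ?_
      · intro s hs
        rw [interior_Icc] at hs
        have hs' : s ∈ Ioo t₀ t₁ := ⟨hs.1, hs.2.trans_le ht.2⟩
        have hne : x s ^ 2 + ε ^ 2 ≠ 0 := by positivity
        exact ((((hd s hs').pow 2).add_const (ε ^ 2)).sqrt hne |>.add (hGd s hs)).hasDerivWithinAt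
      · intro s hs
        rw [interior_Icc] at hs
        have hsI : s ∈ Icc t₀ t₁ := ⟨hs.1.le, hs.2.le.trans ht.2⟩
        have hp : 0 < Real.sqrt (x s ^ 2 + ε ^ 2) := Real.sqrt_pos.2 (by positivity)
        have hkey := previousPair_l1_key (x s) (F s) κ (R s) ε hκ (hRnn s hsI) hε
        have hnum : (↑(2 : ℕ) * x s ^ (2 - 1) * (-(κ * R s * x s) + F s)) /
            (2 * Real.sqrt (x s ^ 2 + ε ^ 2)) =
            x s * (-(κ * R s * x s) + F s) / Real.sqrt (x s ^ 2 + ε ^ 2) := by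
          rw [Nat.cast_ofNat, pow_one, mul_assoc, mul_div_mul_left _ _ two_ne_zero]
        rw [hnum, div_add' _ _ _ hp.ne', div_nonpos_iff]
        exact Or.inr ⟨by nlinarith [hkey], hp.le⟩
    have h := hanti (left_mem_Icc.2 h0t) (right_mem_Icc.2 h0t) h0t
    simp only [intervalIntegral.integral_same, add_zero] at h
    have hsplit : ∫ u in t₀..t, (κ * (R u * |x u|) - κ * ε * R u - |F u|) =
        κ * (∫ u in t₀..t, R u * |x u|) - κ * ε * (∫ u in t₀..t, R u) -
          ∫ u in t₀..t, |F u| := by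
      rw [intervalIntegral.integral_sub ((hIRx.const_mul κ).sub (hIR.const_mul _)) hIF,
        intervalIntegral.integral_sub (hIRx.const_mul κ) (hIR.const_mul _),
        intervalIntegral.integral_const_mul, intervalIntegral.integral_const_mul]
    rw [hsplit] at h
    have hφ0 : Real.sqrt (x t₀ ^ 2 + ε ^ 2) ≤ |x t₀| + ε := by
      refine Real.sqrt_le_iff.2 ⟨by positivity, ?_⟩
      nlinarith [abs_nonneg (x t₀), sq_abs (x t₀), hε.le]
    have hφt : 0 ≤ Real.sqrt (x t ^ 2 + ε ^ 2) := Real.sqrt_nonneg _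
    have hκε : κ * ε * (∫ u in t₀..t, R u) = ε * (κ * ∫ u in t₀..t, R u) := by ring
    nlinarith [h, hφ0, hφt, hκε]
  refine le_of_forall_pos_le_add fun δ hδ => ?_
  have hD : 0 < 1 + κ * ∫ s in t₀..t, R s := by nlinarith
  have h := hεbound (δ / (1 + κ * ∫ s in t₀..t, R s)) (div_pos hδ hD)
  rwa [div_mul_cancel₀ _ hD.ne'] at h

/-- **Energy identity.** If `x' = -κ R x + F` inside `[t₀, t₁]` (everything continuous on the
closed interval), then `2κ ∫_{t₀}^t R x² = x(t₀)² - x(t)² + 2 ∫_{t₀}^t x F`. [folklore] -/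
theorem previousPair_energy {x R F : ℝ → ℝ} {κ t₀ t₁ : ℝ}
    (hx : ContinuousOn x (Icc t₀ t₁)) (hR : ContinuousOn R (Icc t₀ t₁))
    (hF : ContinuousOn F (Icc t₀ t₁))
    (hd : ∀ t ∈ Ioo t₀ t₁, HasDerivAt x (-(κ * R t * x t) + F t) t) {t : ℝ}
    (ht : t ∈ Icc t₀ t₁) :
    2 * κ * ∫ s in t₀..t, R s * x s ^ 2 =
      x t₀ ^ 2 - x t ^ 2 + 2 * ∫ s in t₀..t, x s * F s := by
  have h0t : t₀ ≤ t := ht.1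
  have hx' : ContinuousOn x (Icc t₀ t) := hx.mono (Icc_subset_Icc_right ht.2)
  have hR' : ContinuousOn R (Icc t₀ t) := hR.mono (Icc_subset_Icc_right ht.2)
  have hF' : ContinuousOn F (Icc t₀ t) := hF.mono (Icc_subset_Icc_right ht.2)
  have hderiv : ∀ s ∈ Ioo t₀ t, HasDerivAt (fun s => x s ^ 2)
      (↑(2 : ℕ) * x s ^ (2 - 1) * (-(κ * R s * x s) + F s)) s :=
    fun s hs => (hd s ⟨hs.1, hs.2.trans_le ht.2⟩).pow 2
  have hcont' : ContinuousOn (fun s => ↑(2 : ℕ) * x s ^ (2 - 1) * (-(κ * R s * x s) + F s))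
      (Icc t₀ t) :=
    (continuousOn_const.mul (hx'.pow _)).mul
      ((((continuousOn_const.mul hR').mul hx').neg).add hF')
  have hftc := intervalIntegral.integral_eq_sub_of_hasDerivAt_of_le h0t (hx'.pow 2) hderiv
    (hcont'.intervalIntegrable_of_Icc h0t)
  have heq : ∀ s ∈ Icc t₀ t, ↑(2 : ℕ) * x s ^ (2 - 1) * (-(κ * R s * x s) + F s) =
      -(2 * κ) * (R s * x s ^ 2) + 2 * (x s * F s) := by
    intro s _
    rw [Nat.cast_ofNat]
    ring
  have hi1 : ContinuousOn (fun s => -(2 * κ) * (R s * x s ^ 2)) (Icc t₀ t) :=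
    continuousOn_const.mul (hR'.mul (hx'.pow 2))
  have hi2 : ContinuousOn (fun s => 2 * (x s * F s)) (Icc t₀ t) :=
    continuousOn_const.mul (hx'.mul hF')
  rw [intervalIntegral.integral_congr (fun s hs => heq s (by rwa [uIcc_of_le h0t] at hs)),
    intervalIntegral.integral_add (hi1.intervalIntegrable_of_Icc h0t)
      (hi2.intervalIntegrable_of_Icc h0t),
    intervalIntegral.integral_const_mul, intervalIntegral.integral_const_mul] at hftc
  simp only [Pi.pow_apply] at hftc
  linarith

/-- **Duhamel formula, constant rate.** If `y` is continuous on `[0, t₁]` and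
`y' = -κ y + g` inside with `g` continuous, then
`y(t) = e^{-κ t} (y(0) + ∫₀^t e^{κ s} g(s) ds)` on `[0, t₁]` (both comparison bounds with
`K ≡ -κ`, `f = g`). [folklore] -/
theorem previousPair_duhamel {y g : ℝ → ℝ} {κ t₁ : ℝ} (h01 : 0 ≤ t₁)
    (hy : ContinuousOn y (Icc 0 t₁)) (hg : ContinuousOn g (Icc 0 t₁))
    (hd : ∀ t ∈ Ioo 0 t₁, HasDerivAt y (-(κ * y t) + g t) t) {t : ℝ} (ht : t ∈ Icc 0 t₁) :
    y t = Real.exp (-(κ * t)) * (y 0 + ∫ s in (0 : ℝ)..t, Real.exp (κ * s) * g s) := by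
  have hK : ContinuousOn (fun _ : ℝ => -κ) (Icc 0 t₁) := continuousOn_const
  have hd₁ : ∀ s ∈ Ioo 0 t₁, ∃ y' : ℝ, HasDerivAt y y' s ∧ y' ≤ -κ * y s + g s :=
    fun s hs => ⟨_, hd s hs, by linarith⟩
  have hd₂ : ∀ s ∈ Ioo 0 t₁, ∃ y' : ℝ, HasDerivAt y y' s ∧ -κ * y s + g s ≤ y' :=
    fun s hs => ⟨_, hd s hs, by linarith⟩
  have hup := linearComparison_upper h01 hK hg hy hd₁ ht
  have hlo := linearComparison_lower h01 hK hg hy hd₂ ht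
  simp only [intervalIntegral.integral_const, smul_eq_mul, sub_zero, mul_neg, neg_neg] at hup hlo
  have h1 : Real.exp (-(t * κ)) = Real.exp (-(κ * t)) := by rw [mul_comm]
  have h2 : (∫ s in (0 : ℝ)..t, Real.exp (s * κ) * g s) =
      ∫ s in (0 : ℝ)..t, Real.exp (κ * s) * g s := by
    refine intervalIntegral.integral_congr fun s _ => ?_
    simp only [mul_comm s κ]
  rw [h1, h2] at hup hlo
  exact le_antisymm hup hlo

/-- `(1 + x/8)⁸ ≤ eˣ` for `x ≥ 0`. [folklore] -/
theorem previousPair_pow_eight_le_exp {x : ℝ} (hx : 0 ≤ x) : (1 + x / 8) ^ 8 ≤ Real.exp x := by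
  have h1 : 1 + x / 8 ≤ Real.exp (x / 8) := by linarith [Real.add_one_le_exp (x / 8)]
  have h2 : Real.exp x = Real.exp (x / 8) ^ 8 := by
    rw [← Real.exp_nat_mul]; congr 1; push_cast; ring
  rw [h2]
  exact pow_le_pow_left₀ (by positivity) h1 8

/-- `e⁻ˣ ≤ 1 / 39000` for `x ≥ 22`. [folklore] -/
theorem previousPair_exp_neg_le {x : ℝ} (hx : 22 ≤ x) : Real.exp (-x) ≤ 1 / 39000 := by
  have h1 := previousPair_pow_eight_le_exp (show (0 : ℝ) ≤ 22 by norm_num)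
  have h2 : Real.exp (-x) ≤ Real.exp (-22) := Real.exp_le_exp.2 (by linarith)
  have h3 : Real.exp (-22) = 1 / Real.exp 22 := by rw [Real.exp_neg, one_div]
  rw [h3] at h2
  refine h2.trans ?_
  rw [div_le_div_iff₀ (Real.exp_pos _) (by norm_num : (0 : ℝ) < 39000)]
  nlinarith [h1]

/-- `20 e⁻³ ≥ 1`, i.e. `e³ ≤ 20` is false but `e³ < 20.1`: we record `1 ≤ 20.1 · e⁻ˣ` for
`x ≤ 3` in the form `1 ≤ 201 / 10 * exp (-x)`. [folklore] -/
theorem previousPair_exp_neg_three_ge {x : ℝ} (hx : x ≤ 3) : 1 ≤ 201 / 10 * Real.exp (-x) := by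
  have he := Real.exp_one_lt_d9
  have he0 := Real.exp_pos (1 : ℝ)
  have h3 : Real.exp 3 = Real.exp 1 ^ 3 := by
    rw [← Real.exp_nat_mul]; norm_num
  have h3lt : Real.exp 3 < 201 / 10 := by
    rw [h3]
    exact lt_trans (pow_lt_pow_left₀ he he0.le three_ne_zero) (by norm_num)
  have hmono : Real.exp (-3) ≤ Real.exp (-x) := Real.exp_le_exp.2 (by linarith)
  have hinv : Real.exp (-3) = 1 / Real.exp 3 := by rw [Real.exp_neg, one_div]
  have h4 : 1 ≤ 201 / 10 * Real.exp (-3) := by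
    rw [hinv, mul_one_div, le_div_iff₀ (Real.exp_pos 3)]
    linarith
  nlinarith [hmono]

/-- Closed conditions pass to limits from the left: if `g` is continuous on `[a, b]`,
`a ≤ c < t ≤ b` and `g ≤ C` on `(c, t)`, then `g t ≤ C`. [folklore] -/
theorem previousPair_le_of_Ioo {g : ℝ → ℝ} {a b c t C : ℝ} (hg : ContinuousOn g (Icc a b))
    (hac : a ≤ c) (hct : c < t) (htb : t ≤ b) (h : ∀ s ∈ Ioo c t, g s ≤ C) : g t ≤ C := by
  have htc : t ∈ closure (Ioo c t) := by
    rw [closure_Ioo hct.ne]; exact right_mem_Icc.2 hct.le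
  have hsub : Ioo c t ⊆ Icc a b := fun s hs => ⟨hac.trans hs.1.le, hs.2.le.trans htb⟩
  have hcont : ContinuousWithinAt g (Ioo c t) t := (hg t ⟨hac.trans hct.le, htb⟩).mono hsub
  exact hcont.closure_le htc continuousWithinAt_const h

/-- The same for lower bounds: `C ≤ g` on `(c, t)` gives `C ≤ g t`. [folklore] -/
theorem previousPair_ge_of_Ioo {g : ℝ → ℝ} {a b c t C : ℝ} (hg : ContinuousOn g (Icc a b))
    (hac : a ≤ c) (hct : c < t) (htb : t ≤ b) (h : ∀ s ∈ Ioo c t, C ≤ g s) : C ≤ g t := by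
  have := previousPair_le_of_Ioo (C := -C) hg.neg hac hct htb (fun s hs => by
    simpa using h s hs)
  simpa using this

/-- **Registered sub-goal `stub_previousPairTools`** (tools for the stub `previousPair` of line
`Sketch`, crux `PerpetualPump.AveragedTypeIBlowup`): for `x' = -κ R x + F` on `[t₀, t₁]`,
the `L¹` bound `κ ∫ R |x| ≤ |x(t₀)| + ∫ |F|` when `R ≥ 0`, and the square bound
`x(t)² ≤ c² + e^{-κ∫R} x(t₀)²` when `R > 0` and `|F| ≤ c κ R`. [folklore] -/
theorem stub_previousPairTools :
    (∀ (x R F : ℝ → ℝ) (κ t₀ t₁ : ℝ), 0 ≤ κ →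
      ContinuousOn x (Icc t₀ t₁) → ContinuousOn R (Icc t₀ t₁) → ContinuousOn F (Icc t₀ t₁) →
      (∀ t ∈ Ioo t₀ t₁, HasDerivAt x (-(κ * R t * x t) + F t) t) →
      (∀ t ∈ Icc t₀ t₁, 0 ≤ R t) →
      ∀ t ∈ Icc t₀ t₁, κ * ∫ s in t₀..t, R s * |x s| ≤ |x t₀| + ∫ s in t₀..t, |F s|) ∧
    (∀ (x R F : ℝ → ℝ) (κ c t₀ t₁ : ℝ), t₀ ≤ t₁ → 0 < κ →
      ContinuousOn x (Icc t₀ t₁) → ContinuousOn R (Icc t₀ t₁) →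
      (∀ t ∈ Ioo t₀ t₁, HasDerivAt x (-(κ * R t * x t) + F t) t) →
      (∀ t ∈ Icc t₀ t₁, 0 < R t) → (∀ t ∈ Icc t₀ t₁, |F t| ≤ c * (κ * R t)) →
      ∀ t ∈ Icc t₀ t₁, x t ^ 2 ≤ c ^ 2 + Real.exp (-(κ * ∫ s in t₀..t, R s)) * x t₀ ^ 2) :=
  ⟨fun _ _ _ _ _ _ hκ hx hR hF hd hRnn _ ht => previousPair_l1_le hκ hx hR hF hd hRnn ht,
    fun _ _ _ _ _ _ _ h01 hκ hx hR hd hRpos hFR _ ht =>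
      previousPair_sq_le h01 hκ hx hR hd hRpos hFR ht⟩

end Summit.NavierStokesRegularity.NavierStokesRegularity.Theorems.PerpetualPumpAveragedTypeIBlowup

end
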